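import Summits.CriticalPhenomena.CardyFormulaZ2.Theorems.IKLinearTransport.Negative.CruxConsequences

/-!
# `IKLinearTransport` (route `CardyIKTransport`, stmt-CriticalPhenomena-5076) is FALSE without the
# axis bits of the gauge and without the endpoint slack of the crude event

Load-bearing certificates for the crux `CardyIKTransport.IKLinearTransport` (cdisprove unit, refuter
`refuter-cdisprove-stmt-CriticalPhenomena-5076-0`), "any proof must use H" form; each mutated
statement is the verbatim crux with one sub-term deleted, INLINED in the type of its refutation (no named
`Prop` is introduced for a false statement; the mutated families are `PnoAxisV` / `PnoSlack`):

* `iKLinearTransport_false_without_axisBits` — the two fair AXIS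
  BIT fields `ω.1, ω.2.1` deleted from the colour rule (colour = bare prefix parity of the plaquette
  defects). Mechanism: the colour field then has a deterministic WHITE CROSS on the coordinate axes at
  every mesh (`not_blkNA_of_eq_zero`); in the conformal rectangle `R₀ = (1-i)·(𝔻; 1, i, -1, -i)` the
  arcs `0`/`2` lie in `{re ≥ 1}` / `{re ≤ -1}`, so for `0 < δ < 1/2` a crude crossing walk would have
  to enter the white column `{v 0 = 0}` (`exists_adj_zero`, discrete intermediate value along the
  walk): the event is EMPTY, `P ≡ 0` on `(0, 1/2)`, against `not_conjugateToTri_of_tendsto`.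
  MORAL: the axis bits are what randomises the gauge (translation invariance; free corner-field box
  marginals); a proof cannot treat them as decoration.
* `iKLinearTransport_false_without_slack` — the `2δ` endpoint slack of
  `embDomainCrossing` deleted (endpoints ON the arcs): the event is void for every `R, δ` because the
  arcs lie in the frontier of the OPEN carrier (`noSlack_not_mem`). MORAL: the statement's content
  sits in the slack convention of the crude event.

These are certificates about the SHAPE of the model/event, not evidence against `IKLinearTransport`
itself, which resists (work file `Cruxes/IKLinearTransport/Disproof.lean`, §4).
-/

noncomputable section

namespace Summit.CriticalPhenomena.CardyFormulaZ2.Theorems.IKLinearTransport.Negative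

open scoped Classical
open Filter Topology Set MeasureTheory
open Literature.Probability.Percolation Literature.Probability.LatticeModels
open Literature.Probability.RandomPlanarGeometry

/-! ## §3 Load-bearing analysis: hypotheses of the MODEL that any proof must use -/

/-- The five-fold bit space of the explicit gauge. [folklore] -/
abbrev Ω : Type := Set ℤ × (Set ℤ × (Set (Site 2) × (Set (Site 2) × Set (Site 2))))

/-- The gauge measure (verbatim). [folklore] -/
def μ5 : Measure Ω :=
  (Literature.Probability.Percolation.sitePercolation ℤ Literature.Probability.Percolation.half).prod ((Literature.Probability.Percolation.sitePercolation ℤ Literature.Probability.Percolation.half).prod ((Literature.Probability.Percolation.sitePercolation (Literature.Probability.LatticeModels.Site 2) (Set.projIcc (0:ℝ) 1 zero_le_one (2 * Real.sqrt 3 - 3))).prod ((Literature.Probability.Percolation.sitePercolation (Literature.Probability.LatticeModels.Site 2) Literature.Probability.Percolation.half).prod (Literature.Probability.Percolation.sitePercolation (Literature.Probability.LatticeModels.Site 2) Literature.Probability.Percolation.half))))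

/-- Plaquette parity field (verbatim, `S = univ`). [folklore] -/
def parU (ω : Ω) (f : Site 2) : Prop :=
  (f 0 ∈ (Set.univ : Set ℤ) ∧ f ∈ ω.2.2.1) ∨ (f 0 ∉ (Set.univ : Set ℤ) ∧ f ∈ ω.2.2.2.1)

/-- Anti-diagonal flags (verbatim, `S = univ`). [folklore] -/
def antiU (ω : Ω) (f : Site 2) : Prop := f 0 ∉ (Set.univ : Set ℤ) ∨ f ∈ ω.2.2.2.2

/-- The square embedding of the cells (verbatim). [folklore] -/
def sqEmb : Site 2 → ℂ := fun v : Site 2 => ((v 0 : ℝ) : ℂ) + ((v 1 : ℝ) : ℂ) * Complex.I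

/-! ### §3a Without the axis bits: a deterministic white cross kills the crux -/

/-- MUTATION 1 — the crux with the two fair AXIS BIT fields switched off: the colour of the cell
`v` is the bare prefix parity of the plaquette defects in the rectangle between `0` and `v` (the
`Xor (v 0 ∈ ω.1) (Xor (v 1 ∈ ω.2.1) ·)` wrapper deleted; everything else verbatim). This is the
mutated FAMILY; the mutated statement is inlined in `iKLinearTransport_false_without_axisBits`. [folklore] -/
def PnoAxisV : ConformalRectangle → ℝ → ℝ := (fun R => let μ := (Literature.Probability.Percolation.sitePercolation ℤ Literature.Probability.Percolation.half).prod ((Literature.Probability.Percolation.sitePercolation ℤ Literature.Probability.Percolation.half).prod ((Literature.Probability.Percolation.sitePercolation (Literature.Probability.LatticeModels.Site 2) (Set.projIcc (0:ℝ) 1 zero_le_one (2 * Real.sqrt 3 - 3))).prod ((Literature.Probability.Percolation.sitePercolation (Literature.Probability.LatticeModels.Site 2) Literature.Probability.Percolation.half).prod (Literature.Probability.Percolation.sitePercolation (Literature.Probability.LatticeModels.Site 2) Literature.Probability.Percolation.half)))); let par : (Set ℤ × (Set ℤ × (Set (Literature.Probability.LatticeModels.Site 2) × (Set (Literature.Probability.LatticeModels.Site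 2) × Set (Literature.Probability.LatticeModels.Site 2))))) → Literature.Probability.LatticeModels.Site 2 → Prop := fun ω f => (f 0 ∈ (Set.univ : Set ℤ) ∧ f ∈ ω.2.2.1) ∨ (f 0 ∉ (Set.univ : Set ℤ) ∧ f ∈ ω.2.2.2.1); let blk : (Set ℤ × (Set ℤ × (Set (Literature.Probability.LatticeModels.Site 2) × (Set (Literature.Probability.LatticeModels.Site 2) × Set (Literature.Probability.LatticeModels.Site 2))))) → Literature.Probability.LatticeModels.Site 2 → Prop := fun ω v => Odd ((Finset.filter (fun f : ℤ × ℤ => par ω ![f.1, f.2]) (Finset.Ico (min 0 (v 0)) (max 0 (v 0)) ×ˢ Finset.Ico (min 0 (v 1)) (max 0 (v 1)))).card); let anti : (Set ℤ × (Set ℤ × (Set (Literature.Probability.LatticeModels.Site 2) × (Set (Literature.Probability.LatticeModels.Site 2) × Set (Literature.Probability.LatticeModels.Site 2))))) → Literature.Probability.LatticeModels.Site 2 → Prop := fun ω f => f 0 ∉ (Set.univ : Set ℤ) ∨ f ∈ ω.2.2.2.2; let edges : (Set ℤ × (Set ℤ × (Set (Literature.Probability.LatticeModels.Site 2) × (Set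 (Literature.Probability.LatticeModels.Site 2) × Set (Literature.Probability.LatticeModels.Site 2))))) → Literature.Probability.Percolation.BondConfig (Literature.Probability.LatticeModels.Site 2) := fun ω => {e | ∃ u v, e = s(u, v) ∧ blk ω u ∧ blk ω v ∧ (v = u + ![1, 0] ∨ v = u + ![0, 1] ∨ (v = u + ![1, 1] ∧ ¬ anti ω u) ∨ (v = u + ![1, -1] ∧ anti ω (u + ![0, -1])))}; fun δ : ℝ => μ.real {ω | edges ω ∈ Literature.Probability.Percolation.embDomainCrossing (fun v : Literature.Probability.LatticeModels.Site 2 => ((v 0 : ℝ) : ℂ) + ((v 1 : ℝ) : ℂ) * Complex.I) R.carrier δ (R.arc 0) (R.arc 2)})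

/-- Black cells of the mutated model. [folklore] -/
def blkNA (ω : Ω) (v : Site 2) : Prop :=
  Odd ((Finset.filter (fun f : ℤ × ℤ => parU ω ![f.1, f.2]) (Finset.Ico (min 0 (v 0)) (max 0 (v 0)) ×ˢ Finset.Ico (min 0 (v 1)) (max 0 (v 1)))).card)

/-- Open edges of the mutated model. [folklore] -/
def edgesNA (ω : Ω) : BondConfig (Site 2) :=
  {e | ∃ u v, e = s(u, v) ∧ blkNA ω u ∧ blkNA ω v ∧ (v = u + ![1, 0] ∨ v = u + ![0, 1] ∨ (v = u + ![1, 1] ∧ ¬ antiU ω u) ∨ (v = u + ![1, -1] ∧ antiU ω (u + ![0, -1])))}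

/-- The mutated family, in closed form. [folklore] -/
def PnoAxis (R : ConformalRectangle) (δ : ℝ) : ℝ :=
  μ5.real {ω | edgesNA ω ∈ embDomainCrossing sqEmb R.carrier δ (R.arc 0) (R.arc 2)}

/-- The closed form IS the verbatim mutated family (the two spellings differ only by the
decidability instance of `· ∈ univ` inside `Finset.filter`). [folklore] -/
theorem pnoAxis_eq_verbatim (R : ConformalRectangle) : PnoAxis R = PnoAxisV R := by
  funext δ
  unfold PnoAxis sqEmb
  simp only [PnoAxisV, μ5, edgesNA, blkNA, parU, antiU]

/-- THE WHITE CROSS: without the axis bits every cell on the coordinate axes is white, at every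
sample point (the defect rectangle between `0` and `v` is empty when `v 0 = 0`). [folklore] -/
theorem not_blkNA_of_eq_zero (ω : Ω) (v : Site 2) (hv : v 0 = 0) : ¬ blkNA ω v := by
  simp [blkNA, hv]

/-- Open edges of the mutated model join black cells whose first coordinates differ by `≤ 1`. [folklore] -/
theorem adj_edgesNA {ω : Ω} {x y : Site 2} (h : (openGraph (edgesNA ω)).Adj x y) :
    blkNA ω x ∧ blkNA ω y ∧ x 0 - 1 ≤ y 0 ∧ y 0 ≤ x 0 + 1 := by
  rw [openGraph_adj] at h
  obtain ⟨⟨u, v, huv, hu, hv, hstep⟩, -⟩ := h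
  have hstep' : v 0 = u 0 + 1 ∨ v 0 = u 0 := by
    rcases hstep with h1 | h1 | ⟨h1, -⟩ | ⟨h1, -⟩ <;> subst h1 <;> simp
  rw [Sym2.eq_iff] at huv
  rcases huv with ⟨rfl, rfl⟩ | ⟨rfl, rfl⟩
  · refine ⟨hu, hv, ?_, ?_⟩ <;> omega
  · refine ⟨hv, hu, ?_, ?_⟩ <;> omega

/-- Discrete intermediate value property along a walk whose steps move the first coordinate by
at most one: from `a 0 ≥ 1` to `b 0 ≤ 0` some step ENTERS the column `{v 0 = 0}`. [folklore] -/
theorem exists_adj_zero {G : SimpleGraph (Site 2)} (hG : ∀ x y, G.Adj x y → x 0 - 1 ≤ y 0)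
    {a b : Site 2} (p : G.Walk a b) : 1 ≤ a 0 → b 0 ≤ 0 → ∃ x y, G.Adj x y ∧ y 0 = 0 := by
  induction p with
  | nil => intro ha hb; omega
  | @cons a c b hac p ih =>
    intro ha hb
    by_cases hc : 1 ≤ c 0
    · exact ih hc hb
    · exact ⟨a, c, hac, by have := hG a c hac; omega⟩

/-- The witness rectangle: the unit disc with marked points `1, i, -1, -i`, carried by the
similarity `z ↦ (1 - i) z`; its arc `0` lies in `{re ≥ 1}` and its arc `2` in `{re ≤ -1}`. [folklore] -/
def rot : ℂ ≃ₜ ℂ := Homeomorph.mulLeft₀ (1 - Complex.I) (by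
  intro h
  have := congrArg Complex.re h
  simp at this)

/-- The witness conformal rectangle `R₀ = (1 - i) · (𝔻; 1, i, -1, -i)`. [folklore] -/
def R0 : ConformalRectangle := ConformalRectangle.unitDisc.map rot

/-- Points of the arcs of `R₀`, parametrised. [folklore] -/
theorem mem_arc_R0 {i : Fin 4} {z : ℂ} (hz : z ∈ R0.arc i) :
    ∃ t ∈ Icc (ConformalRectangle.unitDisc.mark i) (ConformalRectangle.unitDisc.nextMark i),
      z = (1 - Complex.I) * circleMap 0 1 (2 * Real.pi * t) := by
  rw [R0, MarkedDomain.arc_map] at hz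
  obtain ⟨w, ⟨t, ht, rfl⟩, rfl⟩ := hz
  exact ⟨t, ht, rfl⟩

/-- Real part of `(1 - i) e^{iθ}`. [folklore] -/
theorem re_rot_circleMap (θ : ℝ) :
    ((1 - Complex.I) * circleMap 0 1 θ).re = Real.cos θ + Real.sin θ := by
  simp [circleMap, Complex.exp_ofReal_mul_I_re, Complex.exp_ofReal_mul_I_im]

/-- First mark of the unit-disc rectangle. [folklore] -/
theorem unitDisc_mark0 : ConformalRectangle.unitDisc.mark 0 = 0 := by
  simp [ConformalRectangle.unitDisc]

/-- Mark after the first mark of the unit-disc rectangle. [folklore] -/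
theorem unitDisc_nextMark0 : ConformalRectangle.unitDisc.nextMark 0 = 1 / 4 := by
  simp [MarkedDomain.nextMark, ConformalRectangle.unitDisc]

/-- Third mark of the unit-disc rectangle. [folklore] -/
theorem unitDisc_mark2 : ConformalRectangle.unitDisc.mark 2 = 1 / 2 := by
  simp [ConformalRectangle.unitDisc]

/-- Mark after the third mark of the unit-disc rectangle. [folklore] -/
theorem unitDisc_nextMark2 : ConformalRectangle.unitDisc.nextMark 2 = 3 / 4 := by
  simp [MarkedDomain.nextMark, ConformalRectangle.unitDisc]

/-- Arc `0` of `R₀` lies in the half plane `{re ≥ 1}`. [folklore] -/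
theorem one_le_re_of_mem_arc0 {z : ℂ} (hz : z ∈ R0.arc 0) : 1 ≤ z.re := by
  obtain ⟨t, ht, rfl⟩ := mem_arc_R0 hz
  rw [unitDisc_mark0, unitDisc_nextMark0] at ht
  rw [re_rot_circleMap]
  have hθ0 : 0 ≤ 2 * Real.pi * t := by nlinarith [Real.pi_pos, ht.1]
  have hθ1 : 2 * Real.pi * t ≤ Real.pi / 2 := by nlinarith [Real.pi_pos, ht.2]
  have hc0 : 0 ≤ Real.cos (2 * Real.pi * t) :=
    Real.cos_nonneg_of_mem_Icc ⟨by linarith [Real.pi_pos], hθ1⟩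
  have hs0 : 0 ≤ Real.sin (2 * Real.pi * t) :=
    Real.sin_nonneg_of_nonneg_of_le_pi hθ0 (by linarith [Real.pi_pos])
  have hc1 := Real.cos_le_one (2 * Real.pi * t)
  have hs1 := Real.sin_le_one (2 * Real.pi * t)
  nlinarith [Real.cos_sq_add_sin_sq (2 * Real.pi * t)]

/-- Arc `2` of `R₀` lies in the half plane `{re ≤ -1}`. [folklore] -/
theorem re_le_neg_one_of_mem_arc2 {z : ℂ} (hz : z ∈ R0.arc 2) : z.re ≤ -1 := by
  obtain ⟨t, ht, rfl⟩ := mem_arc_R0 hz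
  rw [unitDisc_mark2, unitDisc_nextMark2] at ht
  rw [re_rot_circleMap]
  set θ := 2 * Real.pi * t with hθ
  have hθ0 : Real.pi ≤ θ := by nlinarith [Real.pi_pos, ht.1]
  have hθ1 : θ ≤ Real.pi + Real.pi / 2 := by nlinarith [Real.pi_pos, ht.2]
  have hc0 : Real.cos θ ≤ 0 :=
    Real.cos_nonpos_of_pi_div_two_le_of_le (by linarith [Real.pi_pos]) hθ1
  have hs0 : Real.sin θ ≤ 0 := by
    have h := Real.sin_sub_pi θ
    have : 0 ≤ Real.sin (θ - Real.pi) :=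
      Real.sin_nonneg_of_nonneg_of_le_pi (by linarith) (by linarith [Real.pi_pos])
    linarith
  have hc1 := Real.neg_one_le_cos θ
  have hs1 := Real.neg_one_le_sin θ
  nlinarith [Real.cos_sq_add_sin_sq θ]

/-- Real part of the square embedding. [folklore] -/
@[simp] theorem sqEmb_re (u : Site 2) : (sqEmb u).re = (u 0 : ℝ) := by
  simp [sqEmb]

/-- THE EMPTY EVENT: for `0 < δ < 1/2` no configuration of the mutated model has a crude
crossing of `R₀` — a crossing walk would have to step into the white column `{v 0 = 0}`. [folklore] -/
theorem edgesNA_not_mem {δ : ℝ} (hδ : 0 < δ) (hδ' : δ < 1 / 2) (ω : Ω) :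
    edgesNA ω ∉ embDomainCrossing sqEmb R0.carrier δ (R0.arc 0) (R0.arc 2) := by
  rintro ⟨u, hu, v, hv, huS, hvS, hreach⟩
  have hne0 : (R0.arc 0).Nonempty := ⟨_, R0.pt_mem_arc_self 0⟩
  have hne2 : (R0.arc 2).Nonempty := ⟨_, R0.pt_mem_arc_self 2⟩
  have hu1 : Metric.infDist ((δ : ℂ) * sqEmb u) (R0.arc 0) < 1 := lt_of_le_of_lt hu (by linarith)
  have hv1 : Metric.infDist ((δ : ℂ) * sqEmb v) (R0.arc 2) < 1 := lt_of_le_of_lt hv (by linarith)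
  obtain ⟨a, ha, hda⟩ := (Metric.infDist_lt_iff hne0).1 hu1
  obtain ⟨b, hb, hdb⟩ := (Metric.infDist_lt_iff hne2).1 hv1
  have hra := one_le_re_of_mem_arc0 ha
  have hrb := re_le_neg_one_of_mem_arc2 hb
  have hu0 : 1 ≤ u 0 := by
    have h1 : |((δ : ℂ) * sqEmb u - a).re| ≤ dist ((δ : ℂ) * sqEmb u) a := by
      rw [Complex.dist_eq]; exact Complex.abs_re_le_norm _
    have h2 : |((δ : ℂ) * sqEmb u - a).re| < 1 := lt_of_le_of_lt h1 hda
    rw [abs_lt] at h2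
    simp only [Complex.sub_re, Complex.re_ofReal_mul, sqEmb_re] at h2
    have h3 : 0 < δ * (u 0 : ℝ) := by linarith [h2.1]
    have h4 : (0 : ℝ) < u 0 := (mul_pos_iff_of_pos_left hδ).1 h3
    have h5 : (0 : ℤ) < u 0 := by exact_mod_cast h4
    omega
  have hv0 : v 0 ≤ 0 := by
    have h1 : |((δ : ℂ) * sqEmb v - b).re| ≤ dist ((δ : ℂ) * sqEmb v) b := by
      rw [Complex.dist_eq]; exact Complex.abs_re_le_norm _
    have h2 : |((δ : ℂ) * sqEmb v - b).re| < 1 := lt_of_le_of_lt h1 hdb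
    rw [abs_lt] at h2
    simp only [Complex.sub_re, Complex.re_ofReal_mul, sqEmb_re] at h2
    have h3 : δ * (v 0 : ℝ) < 0 := by linarith [h2.2]
    have h4 : (v 0 : ℝ) < 0 := by
      by_contra hcon
      rw [not_lt] at hcon
      have := mul_nonneg hδ.le hcon
      linarith
    have h5 : v 0 < (0 : ℤ) := by exact_mod_cast h4
    omega
  have hreach' : (openGraph (edgesNA ω)).Reachable u v :=
    hreach.map (SimpleGraph.Embedding.induce _).toHom
  obtain ⟨p⟩ := hreach'
  obtain ⟨x, y, hxy, hy0⟩ := exists_adj_zero (fun x y h => (adj_edgesNA h).2.2.1) p hu0 hv0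
  exact not_blkNA_of_eq_zero ω y hy0 (adj_edgesNA hxy).2.1

/-- Hence the mutated crossing probability of `R₀` vanishes identically for `0 < δ < 1/2`. [folklore] -/
theorem pnoAxis_R0_eq_zero {δ : ℝ} (hδ : 0 < δ) (hδ' : δ < 1 / 2) : PnoAxis R0 δ = 0 := by
  unfold PnoAxis
  have : {ω : Ω | edgesNA ω ∈ embDomainCrossing sqEmb R0.carrier δ (R0.arc 0) (R0.arc 2)} = ∅ :=
    Set.eq_empty_of_forall_notMem fun ω h => edgesNA_not_mem hδ hδ' ω h
  rw [this, measureReal_empty]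

/-- The mutated family tends to `0` in `R₀`. [folklore] -/
theorem tendsto_pnoAxis_R0 : Tendsto (PnoAxis R0) (𝓝[>] 0) (𝓝 0) := by
  refine tendsto_const_nhds.congr' ?_
  filter_upwards [Ioo_mem_nhdsGT (show (0 : ℝ) < 1 / 2 by norm_num)] with δ hδ
  exact (pnoAxis_R0_eq_zero hδ.1 hδ.2).symm

/-- LOAD-BEARING 1. The crux is FALSE once the fair axis bits are removed from the gauge:
`R₀ = (1-i)·𝔻` has mutated crossing probability `0` for all `δ < 1/2` (white cross), whereas the
template forces a limit in `(0,1)` (§2). Any proof of the crux must use the axis bits — they are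
exactly what randomises the gauge and makes the explicit sampling field translation invariant
with free corner-fugacity box marginals. [folklore] -/
theorem iKLinearTransport_false_without_axisBits :
    ¬ (let P : Literature.Probability.RandomPlanarGeometry.ConformalRectangle → ℝ → ℝ := (fun R => let μ := (Literature.Probability.Percolation.sitePercolation ℤ Literature.Probability.Percolation.half).prod ((Literature.Probability.Percolation.sitePercolation ℤ Literature.Probability.Percolation.half).prod ((Literature.Probability.Percolation.sitePercolation (Literature.Probability.LatticeModels.Site 2) (Set.projIcc (0:ℝ) 1 zero_le_one (2 * Real.sqrt 3 - 3))).prod ((Literature.Probability.Percolation.sitePercolation (Literature.Probability.LatticeModels.Site 2) Literature.Probability.Percolation.half).prod (Literature.Probability.Percolation.sitePercolation (Literature.Probability.LatticeModels.Site 2) Literature.Probability.Percolation.half)))); let par : (Set ℤ × (Set ℤ × (Set (Literature.Probability.LatticeModels.Site 2) × (Set (Literature.Probability.LatticeModels.Site 2) × Set (Literature.Probability.LatticeModels.Site 2))))) → Literature.Probability.LatticeModels.Site 2 → Prop := fun ω f => (f 0 ∈ (Set.univ : Set ℤ) ∧ f ∈ ω.2.2.1) ∨ (f 0 ∉ (Set.univ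 : Set ℤ) ∧ f ∈ ω.2.2.2.1); let blk : (Set ℤ × (Set ℤ × (Set (Literature.Probability.LatticeModels.Site 2) × (Set (Literature.Probability.LatticeModels.Site 2) × Set (Literature.Probability.LatticeModels.Site 2))))) → Literature.Probability.LatticeModels.Site 2 → Prop := fun ω v => Odd ((Finset.filter (fun f : ℤ × ℤ => par ω ![f.1, f.2]) (Finset.Ico (min 0 (v 0)) (max 0 (v 0)) ×ˢ Finset.Ico (min 0 (v 1)) (max 0 (v 1)))).card); let anti : (Set ℤ × (Set ℤ × (Set (Literature.Probability.LatticeModels.Site 2) × (Set (Literature.Probability.LatticeModels.Site 2) × Set (Literature.Probability.LatticeModels.Site 2))))) → Literature.Probability.LatticeModels.Site 2 → Prop := fun ω f => f 0 ∉ (Set.univ : Set ℤ) ∨ f ∈ ω.2.2.2.2; let edges : (Set ℤ × (Set ℤ × (Set (Literature.Probability.LatticeModels.Site 2) × (Set (Literature.Probability.LatticeModels.Site 2) × Set (Literature.Probability.LatticeModels.Site 2))))) → Literature.Probability.Percolation.BondConfig (Literature.Probability.LatticeModels.Site 2) := fun ω => {e | ∃ u v, e = s(u, v) ∧ blk ω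 u ∧ blk ω v ∧ (v = u + ![1, 0] ∨ v = u + ![0, 1] ∨ (v = u + ![1, 1] ∧ ¬ anti ω u) ∨ (v = u + ![1, -1] ∧ anti ω (u + ![0, -1])))}; fun δ : ℝ => μ.real {ω | edges ω ∈ Literature.Probability.Percolation.embDomainCrossing (fun v : Literature.Probability.LatticeModels.Site 2 => ((v 0 : ℝ) : ℂ) + ((v 1 : ℝ) : ℂ) * Complex.I) R.carrier δ (R.arc 0) (R.arc 2)}); ∃ K : ℂ ≃L[ℝ] ℂ, ∀ (R : Literature.Probability.RandomPlanarGeometry.ConformalRectangle) (L : ℝ), Filter.Tendsto (P R) (nhdsWithin 0 (Set.Ioi 0)) (nhds L) ↔ Filter.Tendsto (Literature.Probability.Percolation.triDomainCrossingProb (R.map K.toHomeomorph)) (nhdsWithin 0 (Set.Ioi 0)) (nhds L)) := by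
  show ¬ ∃ K : ℂ ≃L[ℝ] ℂ, ConjugateToTri PnoAxisV K
  have h : PnoAxisV = PnoAxis := (funext pnoAxis_eq_verbatim).symm
  rw [h]
  rintro ⟨K, hK⟩
  exact not_conjugateToTri_of_tendsto K (L := 0) (fun h => lt_irrefl _ h.1) tendsto_pnoAxis_R0 hK

/-! ### §3b Without the endpoint slack: the crude event is void -/

/-- MUTATION 2 — the crux with the `2δ` endpoint slack of the crude event removed: the crossing
path must start ON `arc 0` and end ON `arc 2` (rescaled endpoints in the arcs themselves),
everything else verbatim. This is the mutated FAMILY; the mutated statement is inlined in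
`iKLinearTransport_false_without_slack`. [folklore] -/
def PnoSlack : ConformalRectangle → ℝ → ℝ := (fun R => let μ := (Literature.Probability.Percolation.sitePercolation ℤ Literature.Probability.Percolation.half).prod ((Literature.Probability.Percolation.sitePercolation ℤ Literature.Probability.Percolation.half).prod ((Literature.Probability.Percolation.sitePercolation (Literature.Probability.LatticeModels.Site 2) (Set.projIcc (0:ℝ) 1 zero_le_one (2 * Real.sqrt 3 - 3))).prod ((Literature.Probability.Percolation.sitePercolation (Literature.Probability.LatticeModels.Site 2) Literature.Probability.Percolation.half).prod (Literature.Probability.Percolation.sitePercolation (Literature.Probability.LatticeModels.Site 2) Literature.Probability.Percolation.half)))); let par : (Set ℤ × (Set ℤ × (Set (Literature.Probability.LatticeModels.Site 2) × (Set (Literature.Probability.LatticeModels.Site 2) × Set (Literature.Probability.LatticeModels.Site 2))))) → Literature.Probability.LatticeModels.Site 2 → Prop := fun ω f => (f 0 ∈ (Set.univ : Set ℤ) ∧ f ∈ ω.2.2.1) ∨ (f 0 ∉ (Set.univ : Set ℤ) ∧ f ∈ ω.2.2.2.1); let blk : (Set ℤ × (Set ℤ × (Set (Literature.Probability.LatticeModels.Site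 2) × (Set (Literature.Probability.LatticeModels.Site 2) × Set (Literature.Probability.LatticeModels.Site 2))))) → Literature.Probability.LatticeModels.Site 2 → Prop := fun ω v => Xor (v 0 ∈ ω.1) (Xor (v 1 ∈ ω.2.1) (Odd ((Finset.filter (fun f : ℤ × ℤ => par ω ![f.1, f.2]) (Finset.Ico (min 0 (v 0)) (max 0 (v 0)) ×ˢ Finset.Ico (min 0 (v 1)) (max 0 (v 1)))).card))); let anti : (Set ℤ × (Set ℤ × (Set (Literature.Probability.LatticeModels.Site 2) × (Set (Literature.Probability.LatticeModels.Site 2) × Set (Literature.Probability.LatticeModels.Site 2))))) → Literature.Probability.LatticeModels.Site 2 → Prop := fun ω f => f 0 ∉ (Set.univ : Set ℤ) ∨ f ∈ ω.2.2.2.2; let edges : (Set ℤ × (Set ℤ × (Set (Literature.Probability.LatticeModels.Site 2) × (Set (Literature.Probability.LatticeModels.Site 2) × Set (Literature.Probability.LatticeModels.Site 2))))) → Literature.Probability.Percolation.BondConfig (Literature.Probability.LatticeModels.Site 2) := fun ω => {e | ∃ u v, e = s(u, v) ∧ blk ω u ∧ blk ω v ∧ (v = u + ![1, 0] ∨ v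 = u + ![0, 1] ∨ (v = u + ![1, 1] ∧ ¬ anti ω u) ∨ (v = u + ![1, -1] ∧ anti ω (u + ![0, -1])))}; fun δ : ℝ => μ.real {ω | edges ω ∈ Literature.Probability.Percolation.openCrossing {y : Literature.Probability.LatticeModels.Site 2 | (δ : ℂ) * (((y 0 : ℝ) : ℂ) + ((y 1 : ℝ) : ℂ) * Complex.I) ∈ R.carrier} {u | (δ : ℂ) * (((u 0 : ℝ) : ℂ) + ((u 1 : ℝ) : ℂ) * Complex.I) ∈ R.arc 0} {v | (δ : ℂ) * (((v 0 : ℝ) : ℂ) + ((v 1 : ℝ) : ℂ) * Complex.I) ∈ R.arc 2}})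

/-- With zero slack the crossing event is EMPTY for every rectangle, mesh and configuration:
an endpoint would lie both in the open carrier and on an arc, i.e. in the frontier. [folklore] -/
theorem noSlack_not_mem (R : ConformalRectangle) (δ : ℝ) (E : BondConfig (Site 2)) :
    E ∉ openCrossing {y : Site 2 | (δ : ℂ) * (((y 0 : ℝ) : ℂ) + ((y 1 : ℝ) : ℂ) * Complex.I) ∈ R.carrier}
      {u : Site 2 | (δ : ℂ) * (((u 0 : ℝ) : ℂ) + ((u 1 : ℝ) : ℂ) * Complex.I) ∈ R.arc 0}
      {v : Site 2 | (δ : ℂ) * (((v 0 : ℝ) : ℂ) + ((v 1 : ℝ) : ℂ) * Complex.I) ∈ R.arc 2} := by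
  rintro ⟨u, hu, v, -, huS, -, -⟩
  have hfr := R.arc_subset_frontier 0 hu
  rw [R.isOpen.frontier_eq] at hfr
  exact hfr.2 huS

/-- The slack-free family vanishes identically. [folklore] -/
theorem pnoSlack_eq_zero (R : ConformalRectangle) (δ : ℝ) : PnoSlack R δ = 0 := by
  have key : ∀ (μ : Measure Ω) (f : Ω → BondConfig (Site 2)),
      μ.real {ω | f ω ∈ openCrossing
        {y : Site 2 | (δ : ℂ) * (((y 0 : ℝ) : ℂ) + ((y 1 : ℝ) : ℂ) * Complex.I) ∈ R.carrier}
        {u : Site 2 | (δ : ℂ) * (((u 0 : ℝ) : ℂ) + ((u 1 : ℝ) : ℂ) * Complex.I) ∈ R.arc 0}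
        {v : Site 2 | (δ : ℂ) * (((v 0 : ℝ) : ℂ) + ((v 1 : ℝ) : ℂ) * Complex.I) ∈ R.arc 2}} = 0 := by
    intro μ f
    have : {ω | f ω ∈ openCrossing
        {y : Site 2 | (δ : ℂ) * (((y 0 : ℝ) : ℂ) + ((y 1 : ℝ) : ℂ) * Complex.I) ∈ R.carrier}
        {u : Site 2 | (δ : ℂ) * (((u 0 : ℝ) : ℂ) + ((u 1 : ℝ) : ℂ) * Complex.I) ∈ R.arc 0}
        {v : Site 2 | (δ : ℂ) * (((v 0 : ℝ) : ℂ) + ((v 1 : ℝ) : ℂ) * Complex.I) ∈ R.arc 2}} = ∅ :=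
      Set.eq_empty_of_forall_notMem fun ω h => noSlack_not_mem R δ (f ω) h
    rw [this, measureReal_empty]
  exact key _ _

/-- LOAD-BEARING 2. The crux is FALSE once the endpoint slack is removed: the mutated family is
identically `0`, the template forces limits in `(0,1)`. The content of the crux therefore sits in
the slack convention of `embDomainCrossing` (endpoints within `2δ` of the arcs, all vertices in the
OPEN carrier); G02's canonical event avoids this by discretising the closed domain. [folklore] -/
theorem iKLinearTransport_false_without_slack :
    ¬ (let P : Literature.Probability.RandomPlanarGeometry.ConformalRectangle → ℝ → ℝ := (fun R => let μ := (Literature.Probability.Percolation.sitePercolation ℤ Literature.Probability.Percolation.half).prod ((Literature.Probability.Percolation.sitePercolation ℤ Literature.Probability.Percolation.half).prod ((Literature.Probability.Percolation.sitePercolation (Literature.Probability.LatticeModels.Site 2) (Set.projIcc (0:ℝ) 1 zero_le_one (2 * Real.sqrt 3 - 3))).prod ((Literature.Probability.Percolation.sitePercolation (Literature.Probability.LatticeModels.Site 2) Literature.Probability.Percolation.half).prod (Literature.Probability.Percolation.sitePercolation (Literature.Probability.LatticeModels.Site 2) Literature.Probability.Percolation.half)))); let par : (Set ℤ × (Set ℤ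 × (Set (Literature.Probability.LatticeModels.Site 2) × (Set (Literature.Probability.LatticeModels.Site 2) × Set (Literature.Probability.LatticeModels.Site 2))))) → Literature.Probability.LatticeModels.Site 2 → Prop := fun ω f => (f 0 ∈ (Set.univ : Set ℤ) ∧ f ∈ ω.2.2.1) ∨ (f 0 ∉ (Set.univ : Set ℤ) ∧ f ∈ ω.2.2.2.1); let blk : (Set ℤ × (Set ℤ × (Set (Literature.Probability.LatticeModels.Site 2) × (Set (Literature.Probability.LatticeModels.Site 2) × Set (Literature.Probability.LatticeModels.Site 2))))) → Literature.Probability.LatticeModels.Site 2 → Prop := fun ω v => Xor (v 0 ∈ ω.1) (Xor (v 1 ∈ ω.2.1) (Odd ((Finset.filter (fun f : ℤ × ℤ => par ω ![f.1, f.2]) (Finset.Ico (min 0 (v 0)) (max 0 (v 0)) ×ˢ Finset.Ico (min 0 (v 1)) (max 0 (v 1)))).card))); let anti : (Set ℤ × (Set ℤ × (Set (Literature.Probability.LatticeModels.Site 2) × (Set (Literature.Probability.LatticeModels.Site 2) × Set (Literature.Probability.LatticeModels.Site 2))))) → Literature.Probability.LatticeModels.Site 2 → Prop := fun ω f => f 0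 ∉ (Set.univ : Set ℤ) ∨ f ∈ ω.2.2.2.2; let edges : (Set ℤ × (Set ℤ × (Set (Literature.Probability.LatticeModels.Site 2) × (Set (Literature.Probability.LatticeModels.Site 2) × Set (Literature.Probability.LatticeModels.Site 2))))) → Literature.Probability.Percolation.BondConfig (Literature.Probability.LatticeModels.Site 2) := fun ω => {e | ∃ u v, e = s(u, v) ∧ blk ω u ∧ blk ω v ∧ (v = u + ![1, 0] ∨ v = u + ![0, 1] ∨ (v = u + ![1, 1] ∧ ¬ anti ω u) ∨ (v = u + ![1, -1] ∧ anti ω (u + ![0, -1])))}; fun δ : ℝ => μ.real {ω | edges ω ∈ Literature.Probability.Percolation.openCrossing {y : Literature.Probability.LatticeModels.Site 2 | (δ : ℂ) * (((y 0 : ℝ) : ℂ) + ((y 1 : ℝ) : ℂ) * Complex.I) ∈ R.carrier} {u | (δ : ℂ) * (((u 0 : ℝ) : ℂ) + ((u 1 : ℝ) : ℂ) * Complex.I) ∈ R.arc 0} {v | (δ : ℂ) * (((v 0 : ℝ) : ℂ) + ((v 1 : ℝ) : ℂ) * Complex.I) ∈ R.arc 2}}); ∃ K : ℂ ≃L[ℝ]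 ℂ, ∀ (R : Literature.Probability.RandomPlanarGeometry.ConformalRectangle) (L : ℝ), Filter.Tendsto (P R) (nhdsWithin 0 (Set.Ioi 0)) (nhds L) ↔ Filter.Tendsto (Literature.Probability.Percolation.triDomainCrossingProb (R.map K.toHomeomorph)) (nhdsWithin 0 (Set.Ioi 0)) (nhds L)) := by
  show ¬ ∃ K : ℂ ≃L[ℝ] ℂ, ConjugateToTri PnoSlack K
  rintro ⟨K, hK⟩
  refine not_conjugateToTri_of_tendsto K (R := R0) (L := 0) (fun h => lt_irrefl _ h.1) ?_ hK
  have : PnoSlack R0 = fun _ => 0 := funext fun δ => pnoSlack_eq_zero R0 δ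
  rw [this]
  exact tendsto_const_nhds




end Summit.CriticalPhenomena.CardyFormulaZ2.Theorems.IKLinearTransport.Negative

end
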